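import Mathlib
import Summits.ValiantsHypothesis.ValiantsHypothesis.Theorems.NewtonUnitEquationsDissociatedUniformTotalsLawConstant
import HarnessLib

/-!
# Crux `NewtonUnitEquations.DissociatedUniform` (stmt-ValiantsHypothesis-5905), `n = 3` totals law: the leading constant `2`
# is ATTAINED at every `q ≥ 2` (an exact count, symbolic in `q`)

The typed sharp law `TotalsLaw.SharpTotalsLawThree C` reads `T(a,b,c) ≤ 2|G|² + C|G|`, and every census of the programme
(NOTES-d1g3 §3, kit j298398; NOTES-t1g2 … t1g7) puts the supremum of `T/q²` at exactly `2`, attained by the "third curve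
negligible" regime in which every class is the full pair sumset `A + B`.  The kernel so far only knew small-`q` witnesses
(`not_totalsLawThree_one` over `ℤ/2`, `not_totalsLawThree_two` over `ℤ/4`) and the UPPER bound `totalVert_const_le :
T ≤ 2|G|² + |G|` on the degenerate stratum `c ≡ c₀`.  This file makes the matching LOWER bound a theorem for EVERY modulus:

* `sqCurve q`, `sqCurve' q : ZMod q → ℝ²` — the integer parabolas `k ↦ (k, k²)` and `k ↦ (k, k² + k)` (`k = val`);
* `isStrictTop_sqCurve` / `isStrictTop_sqCurve'` — for `n ≤ 2q − 2` the integer weight `(2n+1, −2)` exposes the letter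
  `⌈n/2⌉` of the first and `⌊n/2⌋` of the second parabola (a concave integer quadratic with a non-half-integer apex has a unique
  integer maximiser), and `(−(2q−1), 2)` exposes `0`, resp. `q − 1`;
* `ncard_extremePoints_sqCurves : V(A + B) = 2q` — the `2q − 1` lower vertices `a ⌈n/2⌉ + b ⌊n/2⌋` (first coordinate `n`, all
  distinct) and the top vertex `a 0 + b (q−1)` are strict tops of `A + B` (support sets add, `IsStrictTop.add`), hence hull
  vertices; the planar Minkowski bound `V(A+B) ≤ V(A) + V(B) ≤ 2q` of the tree closes the count;
* **`totalVert_sqCurves_const : T(sqCurve, sqCurve', c ≡ c₀) = 2 q²`** for every `q ≥ 2` and every `c₀` (via the exact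
  class count `classVert_const_eq` of the degenerate stratum), and `exists_totalVert_eq_two_mul_sq`;
* consequences for the typed statements: `lt_of_totalVert_le` (any bound `T ≤ C q² ` valid at ONE `q ≥ 2` has `C ≥ 2`, so no
  `TotalsLawThreeCyclic C` / `TotalsLawThree C` with `C < 2` — uniformly in `q`, not just at `q ∈ {2, 4}`), and
  `SharpTotalsLawThree` cannot lose its `q²`-coefficient at any `q` (`two_mul_sq_le_of_sharp_shape`).

Deliberately NOT here: the third curve is CONSTANT (the typed laws quantify over all curves `G → ℝ²`, injectivity is not part of
the statement; the census regime "c tiny but injective" has the same count by `…TotalsLawSmallThird`, not re-derived); no claim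
about the `O(q)` term (small-`q` designs exceed `2q²` by `≈ 2q`, `…TotalsLawQuaternary`); the law itself stays OPEN.
VP ≠ VNP is not proved by anything here.
[folklore: a strictly concave function on the integers with apex strictly between two consecutive half-integers has a unique
integer maximiser; vertices of a Minkowski sum of two convex polygons]
-/

set_option linter.dupNamespace false -- `ValiantsHypothesis.ValiantsHypothesis` (summit = problem) in every name

open scoped BigOperators Pointwise

namespace Summit.ValiantsHypothesis.ValiantsHypothesis.Theorems.NewtonUnitEquationsDissociatedUniform

namespace TotalsLaw

open Literature.Computability.AlgebraicComplexity.KPTT.PlanarMinkowski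

namespace SharpFamily

variable {q : ℕ} [NeZero q]

/-- The integer parabola `k ↦ (k, k²)` on the labels `k = 0, …, q − 1` of `ℤ/q`. -/
def sqCurve (q : ℕ) : ZMod q → (Fin 2 → ℝ) := fun z => ![(z.val : ℝ), (z.val : ℝ) ^ 2]

/-- The sheared integer parabola `k ↦ (k, k² + k)` (an affine image of `sqCurve`; its lower edge slopes are the EVEN integers,
those of `sqCurve` the odd ones, so the two polygons have no parallel edges). -/
def sqCurve' (q : ℕ) : ZMod q → (Fin 2 → ℝ) := fun z => ![(z.val : ℝ), (z.val : ℝ) ^ 2 + z.val]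

/-- Pairing of an explicit weight with a point of `sqCurve`. [folklore] -/
theorem dot_sqCurve (u v : ℝ) (z : ZMod q) :
    ![u, v] ⬝ᵥ sqCurve q z = u * z.val + v * (z.val : ℝ) ^ 2 := by
  simp [sqCurve, dotProduct, Fin.sum_univ_two]

/-- Pairing of an explicit weight with a point of `sqCurve'`. [folklore] -/
theorem dot_sqCurve' (u v : ℝ) (z : ZMod q) :
    ![u, v] ⬝ᵥ sqCurve' q z = u * z.val + v * ((z.val : ℝ) ^ 2 + z.val) := by
  simp [sqCurve', dotProduct, Fin.sum_univ_two]

/-- **Unique integer maximiser.**  For naturals `i ≠ v` and `c ∈ {4i − 1, 4i + 1}` (as a real):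
`c·v − 2v² < c·i − 2i²` — the concave quadratic `c t − 2t²` has apex `c/4 ∈ (i − 1/2, i + 1/2)` off the half-integers.
[folklore] -/
theorem quad_lt {i v : ℕ} {c : ℝ} (hc : c = 4 * i - 1 ∨ c = 4 * i + 1) (hv : v ≠ i) :
    c * v - 2 * (v : ℝ) ^ 2 < c * i - 2 * (i : ℝ) ^ 2 := by
  rcases Nat.lt_or_gt_of_ne hv with h | h
  · -- `v < i`: `v + 1 ≤ i`
    have h' : (v : ℝ) + 1 ≤ i := by exact_mod_cast h
    rcases hc with rfl | rfl <;> nlinarith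
  · have h' : (i : ℝ) + 1 ≤ v := by exact_mod_cast h
    rcases hc with rfl | rfl <;> nlinarith

/-- The letter set of a curve as a `Finset`. -/
noncomputable def pts (a : ZMod q → (Fin 2 → ℝ)) : Finset (Fin 2 → ℝ) := Finset.univ.image a

/-- `↑(pts a) = Set.range a`. [folklore] -/
theorem coe_pts (a : ZMod q → (Fin 2 → ℝ)) : ((pts a : Finset (Fin 2 → ℝ)) : Set (Fin 2 → ℝ)) = Set.range a := by
  rw [pts, Finset.coe_image, Finset.coe_univ, Set.image_univ]

/-- Membership in `pts`. [folklore] -/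
theorem mem_pts {a : ZMod q → (Fin 2 → ℝ)} {y : Fin 2 → ℝ} : y ∈ pts a ↔ ∃ z, a z = y := by
  simp [pts]

/-- **Lower vertices, first parabola.**  For `n ≤ 2q − 2` the weight `(2n+1, −2)` exposes the letter `i = ⌈n/2⌉ = (n+1)/2`
of `sqCurve`. [folklore] -/
theorem isStrictTop_sqCurve {n : ℕ} (hn : n + 1 < 2 * q) :
    IsStrictTop ![(2 * n + 1 : ℝ), -2] (pts (sqCurve q)) (sqCurve q (((n + 1) / 2 : ℕ) : ZMod q)) := by
  have hi : (n + 1) / 2 < q := by omega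
  refine ⟨mem_pts.2 ⟨_, rfl⟩, fun y hy hne => ?_⟩
  obtain ⟨z, rfl⟩ := mem_pts.1 hy
  have hzv : z.val ≠ (n + 1) / 2 := by
    intro h
    apply hne
    have : z = (((n + 1) / 2 : ℕ) : ZMod q) := by
      rw [← h, ZMod.natCast_zmod_val]
    rw [this]
  rw [dot_sqCurve, dot_sqCurve, ZMod.val_cast_of_lt hi]
  have hc : (2 * n + 1 : ℝ) = 4 * (((n + 1) / 2 : ℕ) : ℕ) - 1 ∨ (2 * n + 1 : ℝ) = 4 * (((n + 1) / 2 : ℕ) : ℕ) + 1 := by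
    rcases Nat.even_or_odd n with ⟨m, hm⟩ | ⟨m, hm⟩
    · right
      have : (n + 1) / 2 = m := by omega
      rw [this]; push_cast [hm]; ring
    · left
      have : (n + 1) / 2 = m + 1 := by omega
      rw [this]; push_cast [hm]; ring
  have := quad_lt hc hzv
  linarith

/-- **Lower vertices, second parabola.**  For `n ≤ 2q − 2` the weight `(2n+1, −2)` exposes the letter `j = ⌊n/2⌋` of
`sqCurve'` (`(2n+1)k − 2(k² + k) = (2n−1)k − 2k²`). [folklore] -/
theorem isStrictTop_sqCurve' {n : ℕ} (hn : n + 1 < 2 * q) :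
    IsStrictTop ![(2 * n + 1 : ℝ), -2] (pts (sqCurve' q)) (sqCurve' q ((n / 2 : ℕ) : ZMod q)) := by
  have hj : n / 2 < q := by omega
  refine ⟨mem_pts.2 ⟨_, rfl⟩, fun y hy hne => ?_⟩
  obtain ⟨z, rfl⟩ := mem_pts.1 hy
  have hzv : z.val ≠ n / 2 := by
    intro h
    apply hne
    have : z = ((n / 2 : ℕ) : ZMod q) := by
      rw [← h, ZMod.natCast_zmod_val]
    rw [this]
  rw [dot_sqCurve', dot_sqCurve', ZMod.val_cast_of_lt hj]
  have hc : (2 * n - 1 : ℝ) = 4 * ((n / 2 : ℕ) : ℕ) - 1 ∨ (2 * n - 1 : ℝ) = 4 * ((n / 2 : ℕ) : ℕ) + 1 := by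
    rcases Nat.even_or_odd n with ⟨m, hm⟩ | ⟨m, hm⟩
    · left
      have : n / 2 = m := by omega
      rw [this]; push_cast [hm]; ring
    · right
      have : n / 2 = m := by omega
      rw [this]; push_cast [hm]; ring
  have := quad_lt hc hzv
  linarith

/-- **Top vertex, first parabola.**  The weight `(−(2q−1), 2)` exposes the letter `0` of `sqCurve`
(`2k² − (2q−1)k < 0` for `0 < k ≤ q − 1`). [folklore] -/
theorem isStrictTop_sqCurve_zero :
    IsStrictTop ![(-(2 * q - 1) : ℝ), 2] (pts (sqCurve q)) (sqCurve q 0) := by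
  refine ⟨mem_pts.2 ⟨_, rfl⟩, fun y hy hne => ?_⟩
  obtain ⟨z, rfl⟩ := mem_pts.1 hy
  have hz0 : z.val ≠ 0 := by
    intro h
    exact hne (by rw [(ZMod.val_eq_zero z).1 h])
  rw [dot_sqCurve, dot_sqCurve, ZMod.val_zero]
  have hlt : z.val < q := ZMod.val_lt z
  have h1 : (1 : ℝ) ≤ z.val := by exact_mod_cast Nat.one_le_iff_ne_zero.2 hz0
  have h2 : (z.val : ℝ) + 1 ≤ q := by exact_mod_cast hlt
  push_cast
  nlinarith

/-- **Top vertex, second parabola.**  For `q ≥ 2` the weight `(−(2q−1), 2)` exposes the letter `q − 1` of `sqCurve'`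
(`2(k² + k) − (2q−1)k = k(2k − 2q + 3)` is `q − 1` at `k = q − 1` and `≤ 0` for `k ≤ q − 2`). [folklore] -/
theorem isStrictTop_sqCurve'_last (hq : 2 ≤ q) :
    IsStrictTop ![(-(2 * q - 1) : ℝ), 2] (pts (sqCurve' q)) (sqCurve' q (((q - 1 : ℕ)) : ZMod q)) := by
  have hq1 : q - 1 < q := by omega
  refine ⟨mem_pts.2 ⟨_, rfl⟩, fun y hy hne => ?_⟩
  obtain ⟨z, rfl⟩ := mem_pts.1 hy
  have hzv : z.val ≠ q - 1 := by
    intro h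
    apply hne
    have : z = ((q - 1 : ℕ) : ZMod q) := by
      rw [← h, ZMod.natCast_zmod_val]
    rw [this]
  rw [dot_sqCurve', dot_sqCurve', ZMod.val_cast_of_lt hq1]
  have hlt : z.val < q := ZMod.val_lt z
  have hle : z.val + 2 ≤ q := by omega
  have h2 : (z.val : ℝ) + 2 ≤ q := by exact_mod_cast hle
  have h0 : (0 : ℝ) ≤ z.val := by positivity
  have hq' : ((q - 1 : ℕ) : ℝ) = q - 1 := by
    rw [Nat.cast_sub (by omega)]; simp
  rw [hq']
  nlinarith

/-- The `n`-th lower vertex of `A + B`: `a ⌈n/2⌉ + b ⌊n/2⌋`. -/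
noncomputable def lowerVertex (q : ℕ) (n : ℕ) : Fin 2 → ℝ :=
  sqCurve q (((n + 1) / 2 : ℕ) : ZMod q) + sqCurve' q ((n / 2 : ℕ) : ZMod q)

/-- The top vertex of `A + B`: `a 0 + b (q − 1)`. -/
noncomputable def topVertex (q : ℕ) : Fin 2 → ℝ :=
  sqCurve q (0 : ZMod q) + sqCurve' q (((q - 1 : ℕ)) : ZMod q)

omit [NeZero q] in
/-- The first coordinate of the `n`-th lower vertex is `n` (`⌈n/2⌉ + ⌊n/2⌋ = n`). [folklore] -/
theorem lowerVertex_apply_zero {n : ℕ} (hn : n + 1 < 2 * q) : lowerVertex q n 0 = n := by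
  have hi : (n + 1) / 2 < q := by omega
  have hj : n / 2 < q := by omega
  simp only [lowerVertex, sqCurve, sqCurve', Pi.add_apply, Matrix.cons_val_zero, ZMod.val_cast_of_lt hi,
    ZMod.val_cast_of_lt hj]
  have : (n + 1) / 2 + n / 2 = n := by omega
  exact_mod_cast this

omit [NeZero q] in
/-- The second coordinate of the `n`-th lower vertex is `i² + j² + j ≤ n²` (`i = ⌈n/2⌉`, `j = ⌊n/2⌋`). [folklore] -/
theorem lowerVertex_apply_one_le {n : ℕ} (hn : n + 1 < 2 * q) : lowerVertex q n 1 ≤ (n : ℝ) ^ 2 := by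
  have hi : (n + 1) / 2 < q := by omega
  have hj : n / 2 < q := by omega
  simp only [lowerVertex, sqCurve, sqCurve', Pi.add_apply, Matrix.cons_val_one, Matrix.cons_val_zero,
    ZMod.val_cast_of_lt hi, ZMod.val_cast_of_lt hj]
  have hsum : (((n + 1) / 2 : ℕ) : ℝ) + ((n / 2 : ℕ) : ℝ) = n := by
    have : (n + 1) / 2 + n / 2 = n := by omega
    exact_mod_cast this
  have h0 : (0 : ℝ) ≤ ((n + 1) / 2 : ℕ) := by positivity
  have h1 : (0 : ℝ) ≤ (n / 2 : ℕ) := by positivity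
  -- `j ≤ 2 i j + …`: either `j = 0` or `i ≥ 1`
  have hij : ((n / 2 : ℕ) : ℝ) ≤ 2 * (((n + 1) / 2 : ℕ) : ℝ) * ((n / 2 : ℕ) : ℝ) := by
    rcases Nat.eq_zero_or_pos (n / 2) with h | h
    · simp [h]
    · have : 1 ≤ (n + 1) / 2 := by omega
      have hi1 : (1 : ℝ) ≤ (((n + 1) / 2 : ℕ) : ℝ) := by exact_mod_cast this
      nlinarith
  nlinarith

omit [NeZero q] in
/-- The top vertex is `(q − 1, (q−1)² + (q−1))`. [folklore] -/
theorem topVertex_apply (hq : 1 ≤ q) :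
    topVertex q 0 = (q : ℝ) - 1 ∧ topVertex q 1 = ((q : ℝ) - 1) ^ 2 + ((q : ℝ) - 1) := by
  have hq1 : q - 1 < q := by omega
  have hc : ((q - 1 : ℕ) : ℝ) = q - 1 := by rw [Nat.cast_sub hq]; simp
  simp only [topVertex, sqCurve, sqCurve', Pi.add_apply, Matrix.cons_val_zero, Matrix.cons_val_one,
    ZMod.val_zero, ZMod.val_cast_of_lt hq1, hc]
  constructor <;> push_cast <;> ring

/-- Each lower vertex is a hull vertex of `A + B` (support sets add). [folklore] -/
theorem lowerVertex_mem_extremePoints {n : ℕ} (hn : n + 1 < 2 * q) :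
    lowerVertex q n ∈ (convexHull ℝ ((pts (sqCurve q) + pts (sqCurve' q) : Finset (Fin 2 → ℝ)) :
      Set (Fin 2 → ℝ))).extremePoints ℝ :=
  ((isStrictTop_sqCurve hn).add (isStrictTop_sqCurve' hn)).mem_extremePoints

/-- The top vertex is a hull vertex of `A + B`. [folklore] -/
theorem topVertex_mem_extremePoints (hq : 2 ≤ q) :
    topVertex q ∈ (convexHull ℝ ((pts (sqCurve q) + pts (sqCurve' q) : Finset (Fin 2 → ℝ)) :
      Set (Fin 2 → ℝ))).extremePoints ℝ :=
  (isStrictTop_sqCurve_zero.add (isStrictTop_sqCurve'_last hq)).mem_extremePoints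

omit [NeZero q] in
/-- The `2q − 1` lower vertices are pairwise distinct (their first coordinates are `0, 1, …, 2q − 2`). [folklore] -/
theorem lowerVertex_injOn : Set.InjOn (lowerVertex q) (Finset.range (2 * q - 1) : Finset ℕ) := by
  intro n hn m hm h
  have hn' : n + 1 < 2 * q := by simp at hn; omega
  have hm' : m + 1 < 2 * q := by simp at hm; omega
  have h0 := congrFun h 0
  rw [lowerVertex_apply_zero hn', lowerVertex_apply_zero hm'] at h0
  exact_mod_cast h0

omit [NeZero q] in
/-- The top vertex is none of the lower vertices (same abscissa `q − 1` only for `n = q − 1`, where the ordinate is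
`≤ (q−1)² < (q−1)² + (q−1)`). [folklore] -/
theorem topVertex_ne_lowerVertex (hq : 2 ≤ q) {n : ℕ} (hn : n + 1 < 2 * q) : topVertex q ≠ lowerVertex q n := by
  intro h
  obtain ⟨h0t, h1t⟩ := topVertex_apply (q := q) (by omega)
  have h0 := congrFun h 0
  have h1 := congrFun h 1
  rw [h0t, lowerVertex_apply_zero hn] at h0
  have hle := lowerVertex_apply_one_le hn
  rw [← h1, h1t, ← h0] at hle
  have hq' : (2 : ℝ) ≤ q := by exact_mod_cast hq
  nlinarith

/-- The explicit vertex list: `2q − 1` lower vertices and the top vertex. -/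
noncomputable def vertexList (q : ℕ) : Finset (Fin 2 → ℝ) :=
  insert (topVertex q) ((Finset.range (2 * q - 1)).image (lowerVertex q))

omit [NeZero q] in
/-- The vertex list has exactly `2q` elements. [folklore] -/
theorem card_vertexList (hq : 2 ≤ q) : (vertexList q).card = 2 * q := by
  rw [vertexList, Finset.card_insert_of_notMem, Finset.card_image_of_injOn lowerVertex_injOn, Finset.card_range]
  · omega
  · intro h
    obtain ⟨n, hn, hEq⟩ := Finset.mem_image.1 h
    have hn' : n + 1 < 2 * q := by simp at hn; omega
    exact topVertex_ne_lowerVertex hq hn' hEq.symm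

/-- Every listed point is a hull vertex of `A + B`. [folklore] -/
theorem vertexList_subset_extremePoints (hq : 2 ≤ q) :
    ((vertexList q : Finset (Fin 2 → ℝ)) : Set (Fin 2 → ℝ)) ⊆
      (convexHull ℝ ((pts (sqCurve q) + pts (sqCurve' q) : Finset (Fin 2 → ℝ)) : Set (Fin 2 → ℝ))).extremePoints ℝ := by
  intro p hp
  rw [Finset.mem_coe, vertexList, Finset.mem_insert, Finset.mem_image] at hp
  rcases hp with rfl | ⟨n, hn, rfl⟩
  · exact topVertex_mem_extremePoints hq
  · have hn' : n + 1 < 2 * q := by simp at hn; omega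
    exact lowerVertex_mem_extremePoints hn'

/-- **Exact vertex count of the pair sumset: `V(A + B) = 2q`** for the two parabolas, `q ≥ 2`.  Lower bound: the `2q` strict
tops above; upper bound: the planar Minkowski bound `V(A+B) ≤ V(A) + V(B) ≤ |A| + |B| ≤ 2q` of the tree. [folklore] -/
theorem ncard_extremePoints_sqCurves (hq : 2 ≤ q) :
    ((convexHull ℝ (Set.range (sqCurve q) + Set.range (sqCurve' q))).extremePoints ℝ).ncard = 2 * q := by
  have hset : Set.range (sqCurve q) + Set.range (sqCurve' q) =
      ((pts (sqCurve q) + pts (sqCurve' q) : Finset (Fin 2 → ℝ)) : Set (Fin 2 → ℝ)) := by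
    rw [Finset.coe_add, coe_pts, coe_pts]
  apply le_antisymm
  · -- upper bound
    calc ((convexHull ℝ (Set.range (sqCurve q) + Set.range (sqCurve' q))).extremePoints ℝ).ncard
        ≤ ((convexHull ℝ (Set.range (sqCurve q))).extremePoints ℝ).ncard +
            ((convexHull ℝ (Set.range (sqCurve' q))).extremePoints ℝ).ncard :=
          ncard_extremePoints_range_add_le _ _
      _ ≤ Fintype.card (ZMod q) + Fintype.card (ZMod q) := by
          gcongr
          · exact (Set.ncard_le_ncard extremePoints_convexHull_subset (Set.finite_range _)).trans
              (ncard_range_le_card _)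
          · exact (Set.ncard_le_ncard extremePoints_convexHull_subset (Set.finite_range _)).trans
              (ncard_range_le_card _)
      _ = 2 * q := by rw [ZMod.card]; ring
  · -- lower bound
    rw [hset, ← card_vertexList hq, ← Set.ncard_coe_finset (vertexList q)]
    exact Set.ncard_le_ncard (vertexList_subset_extremePoints hq)
      ((Finset.finite_toSet _).subset extremePoints_convexHull_subset)

/-- **The leading constant `2` is attained at every modulus: `T(sqCurve, sqCurve', c ≡ c₀) = 2 q²`** (`q ≥ 2`, any `c₀`):
every class is the translate `c₀ + (A + B)` with exactly `2q` hull vertices. [folklore] -/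
theorem totalVert_sqCurves_const (hq : 2 ≤ q) (c₀ : Fin 2 → ℝ) :
    totalVert (sqCurve q) (sqCurve' q) (fun _ => c₀) = 2 * q ^ 2 := by
  unfold totalVert
  simp_rw [classVert_const_eq, ncard_extremePoints_sqCurves hq]
  rw [Finset.sum_const, Finset.card_univ, ZMod.card, smul_eq_mul]
  ring

end SharpFamily

open SharpFamily

/-- **For every `q ≥ 2` some triple of curves over `ℤ/q` has `T = 2q²` exactly.** [folklore] -/
theorem exists_totalVert_eq_two_mul_sq (q : ℕ) [NeZero q] (hq : 2 ≤ q) :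
    ∃ a b c : ZMod q → (Fin 2 → ℝ), totalVert a b c = 2 * q ^ 2 :=
  ⟨sqCurve q, sqCurve' q, fun _ => 0, totalVert_sqCurves_const hq 0⟩

/-- **No totals bound below `2q²` at any single modulus.**  If `T(a,b,c) ≤ B` for all curves over `ℤ/q` (`q ≥ 2`), then
`2q² ≤ B`; in particular a cyclic law `T ≤ C·q²` valid at one `q ≥ 2` already forces `2 ≤ C` (uniformly in `q`, complementing
the small-`q` refutations `not_totalsLawThree_one` (`ℤ/2`) and `not_totalsLawThree_two` (`ℤ/4`)). [folklore] -/
theorem two_mul_sq_le_of_forall_totalVert_le (q : ℕ) [NeZero q] (hq : 2 ≤ q) (B : ℕ)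
    (h : ∀ a b c : ZMod q → (Fin 2 → ℝ), totalVert a b c ≤ B) : 2 * q ^ 2 ≤ B := by
  obtain ⟨a, b, c, habc⟩ := exists_totalVert_eq_two_mul_sq q hq
  rw [← habc]; exact h a b c

/-- The cyclic law with constant `C` forces `2 ≤ C` at EVERY modulus `q ≥ 2` (take `q = 2`: `8 ≤ 4C`). [folklore] -/
theorem two_le_of_totalsLawThreeCyclic (C : ℕ) (h : TotalsLawThreeCyclic C) : 2 ≤ C := by
  have h8 : 2 * 2 ^ 2 ≤ C * 2 ^ 2 := two_mul_sq_le_of_forall_totalVert_le 2 le_rfl (C * 2 ^ 2) (fun a b c => h 2 a b c)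
  omega

/-- **The sharp law is sharp in its leading term at every modulus**: whatever the slack `C`, at each `q ≥ 2` the bound
`2q² + Cq` of `SharpTotalsLawThree C` is achieved up to the `Cq` term — there are curves with `T = 2q²`, so no statement of the
shape `T ≤ 2q² − f(q)` with `f(q) > 0` can hold at that `q`. [folklore] -/
theorem not_totalVert_lt_two_mul_sq (q : ℕ) [NeZero q] (hq : 2 ≤ q) :
    ¬ ∀ a b c : ZMod q → (Fin 2 → ℝ), totalVert a b c < 2 * q ^ 2 := by
  intro h
  obtain ⟨a, b, c, habc⟩ := exists_totalVert_eq_two_mul_sq q hq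
  exact absurd (h a b c) (by rw [habc]; exact lt_irrefl _)

end TotalsLaw

end Summit.ValiantsHypothesis.ValiantsHypothesis.Theorems.NewtonUnitEquationsDissociatedUniform
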